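import Literature.Computability.Cryptography.LWERegevMachineParams
import Literature.Computability.Complexity.ListFoldChecks
import HarnessLib

/-!
# The oracle machine of Regev's decision-to-search reduction, II: reading a sample, its scalars and the tested vector

Topic `Computability/Cryptography` (LWE), grouping namespace `LWE.RegevBricks`, continuing
`LWERegevMachineParams.lean`. The query generator works on contexts

  `v = ⟨w, 1^{idx}⟩` (sample slot `idx < m` of the current query) and `u = ⟨v, 1^{i'}⟩`
  (coordinate `i' < n`), `w = ⟨⟨encodeLWESamples S', r⟩, 1^ι⟩`, `ι` the query number.

This file provides the `FP` string functions reading, from such contexts, the data of the sample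
to transform (Regev 2009, §4, proofs of Lemmas 4.1–4.2) together with their values:

* `sampleV` — the code `lweSampleCode` (`LWESampleCodes.lean`) of the input sample in slot `idx + m ι`
  (`nthLF` on the block code);
  `bvalV = bin b`, `avalU = bin aᵢ'`;
* `cvalF ⟨w, bin p⟩ = bin (chunk p of r mod q)` (`chunkF`, `remFn`); `lvalV = bin l`
  (the fresh scalar, chunk `T n + idx + m ι`), `tvalU = bin t_{j,i'}` (the shift, chunk `i' + n j`);
* `deltaU = [e ≠ none ∧ i' = i]` and **`aprimeU = bin a'ᵢ'`**, the `i'`-th coordinate of the tested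
  vector `a' = a + [e = some (i,k)] · l eᵢ` (`aVec`), all residues as canonical numerals of
  `ZMod.val`.

## References

* O. Regev, *On lattices, learning with errors, random linear codes, and cryptography*, J. ACM 56
  (2009), art. 34, §4, Lemmas 4.1–4.2 (held: arXiv:2401.03703, p. 23). [cite: RegevLWE2009, §4 Lemma 4.1–4.2]
* S. Arora, B. Barak, *Computational Complexity: A Modern Approach*, CUP 2009, §1.3. [cite: AroraBarak2009, §1.3]
-/

noncomputable section

namespace Literature.Computability.Cryptography

namespace LWE

namespace RegevBricks

open _root_.Computability Polynomial Literature.Computability.Complexity Brick Plumb HashBricks RegevReduction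

set_option synthInstance.maxSize 512

/-! ### Contexts -/

/-- The root `w` of a depth-one context `v = ⟨w, 1^{idx}⟩`. [folklore] -/
def rootV : List Bool → List Bool := fstF
/-- The unary slot index of `v`. [folklore] -/
def slotV : List Bool → List Bool := sndF
/-- The root `w` of a depth-two context `u = ⟨⟨w, 1^{idx}⟩, 1^{i'}⟩`. [folklore] -/
def rootU : List Bool → List Bool := fstF ∘ fstF
/-- The unary coordinate index of `u`. [folklore] -/
def ipU : List Bool → List Bool := sndF

/-- `rootV ∈ FP`. [folklore] -/
theorem rootV_mem_FP : rootV ∈ FP := fstF_mem_FP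
/-- `slotV ∈ FP`. [folklore] -/
theorem idxV_mem_FP : slotV ∈ FP := sndF_mem_FP
/-- `rootU ∈ FP`. [folklore] -/
theorem rootU_mem_FP : rootU ∈ FP := comp_mem_FP fstF_mem_FP fstF_mem_FP
/-- `ipU ∈ FP`. [folklore] -/
theorem ipU_mem_FP : ipU ∈ FP := sndF_mem_FP

/-! ### The input sample of a slot -/

section Defs

variable (c c' : ℕ)

/-- `bin (idx + m ι)`: the number of the input sample in slot `idx` of query `ι`. [folklore] -/
def bSlotV : List Bool → List Bool :=
  addFn ∘ fanoutFn (lenBinF ∘ slotV) (prodFn ∘ fanoutFn (bmW c c' ∘ rootV) (bιW ∘ rootV))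

/-- The code `⟨⟨1ⁿ, frames of a⟩, bin b⟩` of the input sample of the slot. [cite: RegevLWE2009, §4] -/
def sampleV : List Bool → List Bool :=
  nthLF ∘ fanoutFn rootV (fanoutFn (bSlotV c c') (inBlkW ∘ rootV))

/-- `bin b` of the input sample. [folklore] -/
def bvalV : List Bool → List Bool := sndF ∘ sampleV c c'

/-- The framed residues of `a` of the input sample. [folklore] -/
def aframesV : List Bool → List Bool := sndF ∘ fstF ∘ sampleV c c'

/-- `bin aᵢ'` of the input sample (depth-two context). [folklore] -/
def avalU : List Bool → List Bool :=
  nthLF ∘ fanoutFn rootU (fanoutFn (lenBinF ∘ ipU) (aframesV c c' ∘ fstF))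

/-- **The value of a coin chunk**: `cvalF ⟨w, bin p⟩ = bin (⟦chunk p of r⟧ mod q)` (chunks of `n`
bits). [cite: RegevLWE2009, §4 (proofs of Lemmas 4.1, 4.2: uniform t, l)] -/
def cvalF : List Bool → List Bool :=
  remFn ∘ fanoutFn (chunkF ∘ fanoutFn fstF (fanoutFn (onesNW ∘ fstF) (fanoutFn sndF (rW ∘ fstF)))) (bqW ∘ fstF)

/-- `bin l`: the fresh scalar of the slot, chunk `T n + (idx + m ι)`. [cite: RegevLWE2009, §4 (proof of Lemma 4.2)] -/
def lvalV : List Bool → List Bool :=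
  cvalF ∘ fanoutFn rootV (addFn ∘ fanoutFn (prodFn ∘ fanoutFn (bTW c c' ∘ rootV) (bnW ∘ rootV)) (bSlotV c c'))

/-- `bin t_{j,i'}`: the `i'`-th shift coordinate of the round, chunk `i' + n j`. [cite: RegevLWE2009, §4 (proof of Lemma 4.1)] -/
def tvalU : List Bool → List Bool :=
  cvalF ∘ fanoutFn rootU (addFn ∘ fanoutFn (lenBinF ∘ ipU) (prodFn ∘ fanoutFn (bnW ∘ rootU) (bjW c c' ∘ rootU)))

/-- The bit `[e ≠ none ∧ i' = i]`: is `i'` the tested coordinate? [cite: RegevLWE2009, §4 (proof of Lemma 4.2)] -/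
def deltaU : List Bool → List Bool :=
  andFn (notFn (isGW c c' ∘ rootU)) (eqValFn ∘ fanoutFn (lenBinF ∘ ipU) (biW c c' ∘ rootU))

/-- **`bin a'ᵢ'`**: the `i'`-th coordinate of the tested vector `a + [test] l eᵢ`, reduced mod `q`.
[cite: RegevLWE2009, §4 (proof of Lemma 4.2: "(a + (l, 0, …, 0), b + l k)")] -/
def aprimeU : List Bool → List Bool :=
  remFn ∘ fanoutFn (addFn ∘ fanoutFn (avalU c c') (iteFn (deltaU c c') (lvalV c c' ∘ fstF) fun _ => []))
    (bqW ∘ rootU)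

end Defs

/-! ### Polynomial time -/

section FP

variable (c c' : ℕ)

/-- `bSlotV ∈ FP`. [folklore] -/
theorem bSlotV_mem_FP : bSlotV c c' ∈ FP :=
  comp_mem_FP addFn_mem_FP (fanoutFn_mem_FP (comp_mem_FP lenBinF_mem_FP idxV_mem_FP)
    (comp_mem_FP prodFn_mem_FP (fanoutFn_mem_FP (comp_mem_FP (bmW_mem_FP c c') rootV_mem_FP)
      (comp_mem_FP bιW_mem_FP rootV_mem_FP))))
/-- `sampleV ∈ FP`. [folklore] -/
theorem sampleV_mem_FP : sampleV c c' ∈ FP :=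
  comp_mem_FP nthLF_mem_FP (fanoutFn_mem_FP rootV_mem_FP (fanoutFn_mem_FP (bSlotV_mem_FP c c')
    (comp_mem_FP bodyW_mem_FP rootV_mem_FP)))
/-- `bvalV ∈ FP`. [folklore] -/
theorem bvalV_mem_FP : bvalV c c' ∈ FP := comp_mem_FP sndF_mem_FP (sampleV_mem_FP c c')
/-- `aframesV ∈ FP`. [folklore] -/
theorem aframesV_mem_FP : aframesV c c' ∈ FP :=
  comp_mem_FP sndF_mem_FP (comp_mem_FP fstF_mem_FP (sampleV_mem_FP c c'))
/-- `avalU ∈ FP`. [folklore] -/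
theorem avalU_mem_FP : avalU c c' ∈ FP :=
  comp_mem_FP nthLF_mem_FP (fanoutFn_mem_FP rootU_mem_FP (fanoutFn_mem_FP (comp_mem_FP lenBinF_mem_FP ipU_mem_FP)
    (comp_mem_FP (aframesV_mem_FP c c') fstF_mem_FP)))
/-- `cvalF ∈ FP`. [folklore] -/
theorem cvalF_mem_FP : cvalF ∈ FP :=
  comp_mem_FP remFn_mem_FP (fanoutFn_mem_FP
    (comp_mem_FP chunkF_mem_FP (fanoutFn_mem_FP fstF_mem_FP (fanoutFn_mem_FP (comp_mem_FP onesNW_mem_FP fstF_mem_FP)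
      (fanoutFn_mem_FP sndF_mem_FP (comp_mem_FP rW_mem_FP fstF_mem_FP)))))
    (comp_mem_FP bqW_mem_FP fstF_mem_FP))
/-- `lvalV ∈ FP`. [folklore] -/
theorem lvalV_mem_FP : lvalV c c' ∈ FP :=
  comp_mem_FP cvalF_mem_FP (fanoutFn_mem_FP rootV_mem_FP (comp_mem_FP addFn_mem_FP (fanoutFn_mem_FP
    (comp_mem_FP prodFn_mem_FP (fanoutFn_mem_FP (comp_mem_FP (bTW_mem_FP c c') rootV_mem_FP)
      (comp_mem_FP bnW_mem_FP rootV_mem_FP))) (bSlotV_mem_FP c c'))))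
/-- `tvalU ∈ FP`. [folklore] -/
theorem tvalU_mem_FP : tvalU c c' ∈ FP :=
  comp_mem_FP cvalF_mem_FP (fanoutFn_mem_FP rootU_mem_FP (comp_mem_FP addFn_mem_FP (fanoutFn_mem_FP
    (comp_mem_FP lenBinF_mem_FP ipU_mem_FP)
    (comp_mem_FP prodFn_mem_FP (fanoutFn_mem_FP (comp_mem_FP bnW_mem_FP rootU_mem_FP)
      (comp_mem_FP (bjW_mem_FP c c') rootU_mem_FP))))))
/-- `deltaU ∈ FP`. [folklore] -/
theorem deltaU_mem_FP : deltaU c c' ∈ FP :=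
  andFn_mem_FP (notFn_mem_FP (comp_mem_FP (isGW_mem_FP c c') rootU_mem_FP))
    (comp_mem_FP eqValFn_mem_FP (fanoutFn_mem_FP (comp_mem_FP lenBinF_mem_FP ipU_mem_FP)
      (comp_mem_FP (biW_mem_FP c c') rootU_mem_FP)))
/-- `deltaU` is one-bit. [folklore] -/
theorem oneBit_deltaU : OneBit (deltaU c c') :=
  oneBit_andFn (oneBit_notFn ((oneBit_isGW c c').comp _)) (oneBit_eqValFn.comp _)
/-- `aprimeU ∈ FP`. [folklore] -/
theorem aprimeU_mem_FP : aprimeU c c' ∈ FP :=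
  comp_mem_FP remFn_mem_FP (fanoutFn_mem_FP
    (comp_mem_FP addFn_mem_FP (fanoutFn_mem_FP (avalU_mem_FP c c')
      (iteFn_mem_FP (deltaU_mem_FP c c') (comp_mem_FP (lvalV_mem_FP c c') fstF_mem_FP) (const_mem_FP _))))
    (comp_mem_FP bqW_mem_FP rootU_mem_FP))

end FP

/-! ### Values -/

section Values

variable {c c' : ℕ} {n q m : ℕ} [NeZero q]
  (S' : Fin (Tpar c c' n * (n * q + 1) * Npar c c' n q * m) → (Fin n → ZMod q) × ZMod q) (r : List Bool)
  (qi : QIdx n q (Npar c c' n q) (Tpar c c' n)) (idx : Fin m) (i' : Fin n)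

/-- The bit "`i'` is the tested coordinate" of query `qi`. [cite: RegevLWE2009, §4 (proof of Lemma 4.2)] -/
def testBit : Bool := match qi.2.1 with
  | none => false
  | some ik => decide (i' = ik.1)

/-- **The tested vector** `a' = a + [e = some (i, k)] · l eᵢ` of the slot. [cite: RegevLWE2009, §4 (proof of Lemma 4.2)] -/
def aVec (n : ℕ) (S' : Fin (Tpar c c' n * (n * q + 1) * Npar c c' n q * m) → (Fin n → ZMod q) × ZMod q)
    (r : List Bool) (qi : QIdx n q (Npar c c' n q) (Tpar c c' n)) (idx : Fin m) : Fin n → ZMod q :=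
  match qi.2.1 with
  | none => (inputOf S' qi idx).1
  | some ik => (inputOf S' qi idx).1 + Pi.single ik.1 (freshOf n r qi idx)

/-- The coordinates of the tested vector. [folklore] -/
theorem aVec_apply : aVec n S' r qi idx i' =
    (inputOf S' qi idx).1 i' + if testBit qi i' then freshOf n r qi idx else 0 := by
  obtain ⟨j, e, rep⟩ := qi
  cases e with
  | none => simp [aVec, testBit]
  | some ik =>
    obtain ⟨i, k⟩ := ik
    by_cases h : i' = i
    · subst h; simp [aVec, testBit]
    · simp [aVec, testBit, h]

/-- The depth-one context of slot `idx`. [folklore] -/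
def vOf : List Bool := boolPair (wOf S' r qi) (ones idx)

/-- The depth-two context of slot `idx`, coordinate `i'`. [folklore] -/
def uOf : List Bool := boolPair (vOf S' r qi idx) (ones i')

/-- `vOf` unfolded. [folklore] -/
theorem vOf_eq : vOf S' r qi idx = boolPair (wOf S' r qi) (ones idx) := rfl
/-- `uOf` unfolded. [folklore] -/
theorem uOf_eq : uOf S' r qi idx i' = boolPair (boolPair (wOf S' r qi) (ones idx)) (ones i') := rfl
/-- Root of `vOf`. [folklore] -/
@[simp] theorem fstF_vOf : fstF (vOf S' r qi idx) = wOf S' r qi := fstF_boolPair _ _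
/-- Index of `vOf`. [folklore] -/
@[simp] theorem sndF_vOf : sndF (vOf S' r qi idx) = ones idx := sndF_boolPair _ _
/-- First field of `uOf`. [folklore] -/
@[simp] theorem fstF_uOf : fstF (uOf S' r qi idx i') = vOf S' r qi idx := fstF_boolPair _ _
/-- Index of `uOf`. [folklore] -/
@[simp] theorem sndF_uOf : sndF (uOf S' r qi idx i') = ones i' := sndF_boolPair _ _

variable {S' r qi idx i'}

/-- Value of `bSlotV`: the number `idx + m ι` of the input sample. [folklore] -/
theorem bSlotV_apply (hn : 0 < n) :
    bSlotV c c' (vOf S' r qi idx) = encodeNat (idx + m * (qIdxEquiv n q (Npar c c' n q) (Tpar c c' n) qi).val) := by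
  have hq : 0 < q := Nat.pos_of_ne_zero (NeZero.ne q)
  simp only [bSlotV, Function.comp_apply, fanoutFn_apply, rootV, slotV, fstF_vOf, sndF_vOf, lenBinF_apply,
    List.length_replicate, wOf_eq, bmW_apply S' r _ hn hq, bιW_apply, prodFn_boolPair, addFn_boolPair, bitsToNat_encodeNat]

/-- The slot number is below the number of samples. [folklore] -/
theorem slot_lt : idx + m * (qIdxEquiv n q (Npar c c' n q) (Tpar c c' n) qi).val < Tpar c c' n * (n * q + 1) * Npar c c' n q * m := by
  have h := (slotEquiv n q m (Npar c c' n q) (Tpar c c' n) (qi, idx)).isLt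
  rwa [slotEquiv_apply_val] at h

/-- The input sample of the slot is sample number `idx + m ι`. [folklore] -/
theorem inputOf_eq : inputOf S' qi idx = S' ⟨idx + m * (qIdxEquiv n q (Npar c c' n q) (Tpar c c' n) qi).val, slot_lt⟩ := by
  rw [inputOf]
  exact congrArg S' (Fin.ext (slotEquiv_apply_val qi idx))

/-- **Value of `sampleV`**: the code `lweSampleCode` of the input sample of the slot. [cite: RegevLWE2009, §4] -/
theorem sampleV_apply (hn : 0 < n) (hm : 0 < m) :
    sampleV c c' (vOf S' r qi idx) = lweSampleCode (inputOf S' qi idx) := by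
  obtain ⟨-, -, -, -, -, hM, -⟩ := bounds_wOf S' r qi hn hm
  have hslot := (slot_lt (qi := qi) (idx := idx)).le.trans hM
  rw [sampleV, Function.comp_apply, fanoutFn_apply, fanoutFn_apply, bSlotV_apply hn]
  simp only [rootV, Function.comp_apply, fstF_vOf]
  rw [wOf_eq, bodyW_apply, lweBlockCode_eq, ← wOf_eq, nthLF_apply _ hslot, inputOf_eq,
    ← getD_sampleList S' ⟨_, slot_lt⟩]

/-- Value of `bvalV`: `bin b`. [folklore] -/
theorem bvalV_apply (hn : 0 < n) (hm : 0 < m) :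
    bvalV c c' (vOf S' r qi idx) = encodeNat ((inputOf S' qi idx).2).val := by
  rw [bvalV, Function.comp_apply, sampleV_apply hn hm, sndF_lweSampleCode]

/-- Value of `aframesV`: the residue code of `a`. [folklore] -/
theorem aframesV_apply (hn : 0 < n) (hm : 0 < m) :
    aframesV c c' (vOf S' r qi idx) = lweResidueCode (inputOf S' qi idx).1 := by
  simp only [aframesV, Function.comp_apply, sampleV_apply hn hm, sndF_fstF_lweSampleCode]

/-- **Value of `avalU`**: `bin aᵢ'`. [folklore] -/
theorem avalU_apply (hn : 0 < n) (hm : 0 < m) :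
    avalU c c' (uOf S' r qi idx i') = encodeNat ((inputOf S' qi idx).1 i').val := by
  obtain ⟨hnw, -⟩ := bounds_wOf S' r qi hn hm
  rw [avalU, Function.comp_apply, fanoutFn_apply, fanoutFn_apply]
  simp only [rootU, ipU, Function.comp_apply, fstF_uOf, sndF_uOf, fstF_vOf, lenBinF_apply, List.length_replicate,
    aframesV_apply hn hm, lweResidueCode_eq]
  rw [nthLF_apply _ (i'.isLt.le.trans hnw), List.getD_eq_getElem _ _ (by rw [length_residueList]; exact i'.isLt),
    getElem_residueList]

/-- **Value of `cvalF`** on `⟨w, bin p⟩` (`p ≤ |w|`, `n ≤ |w|`): `bin ((chunk p of r) mod q)`.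
[cite: RegevLWE2009, §4 (proofs of Lemmas 4.1, 4.2)] -/
theorem cvalF_apply {p : ℕ} (hn : 0 < n) (hm : 0 < m) (hp : p ≤ (wOf S' r qi).length) :
    cvalF (boolPair (wOf S' r qi) (encodeNat p)) = encodeNat (chunkVal n q r p).val := by
  obtain ⟨hnw, -⟩ := bounds_wOf S' r qi hn hm
  simp only [cvalF, Function.comp_apply, fanoutFn_apply, fstF_boolPair, sndF_boolPair]
  rw [wOf_eq, onesNW_apply S' r _ (by rw [← wOf_eq]; exact hnw), rW_apply, bqW_apply, ← wOf_eq, chunkF_apply,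
    bitsToNat_encodeNat, min_eq_left hp, remFn_boolPair, bitsToNat_encodeNat, chunkVal, ZMod.val_natCast]
  rfl

/-- **Value of `lvalV`**: `bin l`, the fresh scalar of the slot. [cite: RegevLWE2009, §4 (proof of Lemma 4.2)] -/
theorem lvalV_apply (hn : 0 < n) (hm : 0 < m) :
    lvalV c c' (vOf S' r qi idx) = encodeNat (freshOf n r qi idx).val := by
  obtain ⟨-, -, -, -, -, -, hL⟩ := bounds_wOf S' r qi hn hm
  have hp : Tpar c c' n * n + (idx + m * (qIdxEquiv n q (Npar c c' n q) (Tpar c c' n) qi).val) ≤ (wOf S' r qi).length :=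
    le_trans (by have := slot_lt (qi := qi) (idx := idx); omega) hL
  rw [lvalV, Function.comp_apply, fanoutFn_apply, Function.comp_apply, fanoutFn_apply, bSlotV_apply hn]
  simp only [rootV, Function.comp_apply, fanoutFn_apply, fstF_vOf]
  rw [wOf_eq, bTW_apply, bnW_apply, ← wOf_eq, prodFn_boolPair, bitsToNat_encodeNat, bitsToNat_encodeNat, addFn_boolPair,
    bitsToNat_encodeNat, bitsToNat_encodeNat, cvalF_apply hn hm hp]
  rfl

/-- **Value of `tvalU`**: `bin t_{j,i'}`, the shift coordinate. [cite: RegevLWE2009, §4 (proof of Lemma 4.1)] -/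
theorem tvalU_apply (hn : 0 < n) (hm : 0 < m) :
    tvalU c c' (uOf S' r qi idx i') = encodeNat ((shiftOf n r qi.1 : Fin n → ZMod q) i').val := by
  obtain ⟨-, -, -, -, -, -, hL⟩ := bounds_wOf S' r qi hn hm
  have hN : 0 < Npar c c' n q := Npar_pos hn (Nat.pos_of_ne_zero (NeZero.ne q))
  obtain ⟨j, e, rep⟩ := qi
  have hp : (i' : ℕ) + n * j ≤ (wOf S' r (j, e, rep)).length := by
    refine le_trans ?_ ((Nat.le_add_right _ _).trans hL)
    have hj : (j : ℕ) + 1 ≤ Tpar c c' n := j.isLt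
    have := i'.isLt
    nlinarith
  rw [tvalU, Function.comp_apply, fanoutFn_apply, Function.comp_apply, fanoutFn_apply]
  simp only [rootU, ipU, Function.comp_apply, fanoutFn_apply, fstF_uOf, sndF_uOf, fstF_vOf, lenBinF_apply,
    List.length_replicate]
  rw [wOf_eq, bnW_apply, bjW_apply S' r j e rep hN, ← wOf_eq, prodFn_boolPair, bitsToNat_encodeNat, bitsToNat_encodeNat,
    addFn_boolPair, bitsToNat_encodeNat, bitsToNat_encodeNat, cvalF_apply hn hm hp]
  rfl

/-- **Value of `deltaU`**: `[testBit qi i']`. [cite: RegevLWE2009, §4 (proof of Lemma 4.2)] -/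
theorem deltaU_apply (hn : 0 < n) : deltaU c c' (uOf S' r qi idx i') = [testBit qi i'] := by
  have hN : 0 < Npar c c' n q := Npar_pos hn (Nat.pos_of_ne_zero (NeZero.ne q))
  obtain ⟨j, e, rep⟩ := qi
  have h1 : notFn (isGW c c' ∘ rootU) (uOf S' r (j, e, rep) idx i') = [!decide (e = none)] :=
    notFn_apply (by simp only [rootU, Function.comp_apply, fstF_uOf, fstF_vOf]; rw [wOf_eq]; exact isGW_apply S' r j e rep hN)
  cases e with
  | none =>
    rw [deltaU, andFn, iteFn_apply h1]
    rfl
  | some ik =>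
    obtain ⟨i, k⟩ := ik
    have h2 : (eqValFn ∘ fanoutFn (lenBinF ∘ ipU) (biW c c' ∘ rootU)) (uOf S' r (j, some (i, k), rep) idx i') =
        [decide (i' = i)] := by
      simp only [rootU, ipU, Function.comp_apply, fanoutFn_apply, fstF_uOf, sndF_uOf, fstF_vOf, lenBinF_apply,
        List.length_replicate]
      rw [wOf_eq, biW_apply S' r j rep i k hN, eqValFn_boolPair, bitsToNat_encodeNat, bitsToNat_encodeNat]
      simp [Fin.ext_iff]
    rw [deltaU, andFn_apply h1 h2]
    simp [testBit]

/-- **Value of `aprimeU`**: `bin a'ᵢ'`, the coordinate of the tested vector. [cite: RegevLWE2009, §4 (proof of Lemma 4.2)] -/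
theorem aprimeU_apply (hn : 0 < n) (hm : 0 < m) :
    aprimeU c c' (uOf S' r qi idx i') = encodeNat (aVec n S' r qi idx i').val := by
  have hite : iteFn (deltaU c c') (lvalV c c' ∘ fstF) (fun _ => []) (uOf S' r qi idx i') =
      if testBit qi i' then encodeNat (freshOf n r qi idx).val else [] := by
    rw [iteFn_apply (deltaU_apply hn)]
    by_cases h : testBit qi i'
    · rw [if_pos h, if_pos h, Function.comp_apply, fstF_uOf, lvalV_apply hn hm]
    · rw [if_neg h, if_neg h]
  rw [aprimeU, Function.comp_apply, fanoutFn_apply, Function.comp_apply, fanoutFn_apply, avalU_apply hn hm, hite]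
  simp only [rootU, Function.comp_apply, fstF_uOf, fstF_vOf]
  rw [wOf_eq, bqW_apply, aVec_apply, ZMod.val_add, addFn_boolPair, remFn_boolPair]
  simp only [bitsToNat_encodeNat]
  congr 3
  by_cases h : testBit qi i' <;> simp [h]

end Values

end RegevBricks

end LWE

end Literature.Computability.Cryptography

end
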